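import Summits.ResolutionOfSingularities.ResolutionOfSingularities.Theorems.HilbertSamuelEliminationCampaignW42ConeFrame
import Literature.RingTheory.HilbertSamuel.FibreHilbertBound
import Literature.RingTheory.HilbertSamuel.NormalFlatnessHilbertFunction
import Literature.AlgebraicGeometry.Resolution.RidgeRepresentable
import HarnessLib

/-!
# [OURS · L1 W4.2] Towards ridge confinement at NON-rational closed points, II: Hironaka's base-change
# bound `H⁽¹⁾(L) ≤ Σ_i Φ⁽ⁿ⁾(i) · ℓ(L/(𝔮(Y+Z)L + (Z)^{m+1-i}))` (campaign s42 of cell res-hironaka,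
# LADDER-RESOLUTION rung L; informal crux `RidgeConfinement`, stmt-ResolutionOfSingularities-17845; `--supports`)

HONEST FRAMING. OURS (slot W4.2, prover res-L1-s42-pv-1, gen 2). Sequel of `…CampaignW42ConeFrame.lean`
(`T = K[X]/I`, `𝔮 ⊇ I` a closed point of the cone, `𝔑 = 𝔮T[Z] + (Z)`, `L = (T[Z])_𝔑`, `H⁽⁰⁾(L) = H⁽ⁿ⁾(T_𝔮)`),
written for an arbitrary surjection `π : K[X] ↠ T` with `ker π ⊆ 𝔮` in place of `K[X] → K[X]/I`. Here the
SECOND fibration of `L`, over the regular local ring `G = K[X]_𝔮` through the twisted embedding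
`θ : K[X] → T[Z]`, `s ↦ s(Y + Z)` with coefficients reduced by `π` (the tree's `taylorY`, then `map π`):

* `mk_taylor_eq_mk_C` / `taylor_mem_iff_C_mem` — `θ(s) ≡ s(Y)` modulo `(Z)`; `map_taylor_sup_idealOfVars` — `θ(𝔮)T[Z] + (Z) = 𝔑`;
  `comap_taylor_frameIdeal` — `θ⁻¹(𝔑) = 𝔮`;
* `hilbertFun_localization_mvPolynomial` — `H⁽⁰⁾(K[X]_𝔮) = Φ⁽ⁿ⁾` (`K[X]_𝔮` is regular of dimension `n`:
  Mathlib `IsRegularRing`, tree `MvPolynomial.height_eq_of_isMaximal`);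
* **`hilbertSamuelFun_one_frame_le_sum`** — for every `m`,
  `H⁽¹⁾(L)(m) ≤ Σ_{i ≤ m} Φ⁽ⁿ⁾(i) · ℓ_L(L/(θ(𝔮)L + (Z)^{m+1-i}))`
  (the tree's `FibreHilbertBound.length_quotient_pow_le_sum` for the local homomorphism `G → L` with
  `𝔪_G L + (Z) = 𝔪_L`): Hironaka's base-change inequality [H4] / CJS proof of Thm. 3.10 (p. 47) in the cone
  frame, before the identification of `L/θ(𝔮)L` with the local ring of the base-changed cone `C_κ` at its
  rational point (part III).

NOTHING here is a statement of H. Hironaka's manuscript [Hironaka2017]. AI review is weaker than expert review.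

References (orientation only): V. Cossart, U. Jannsen, S. Saito, LNM 2270 (2020), Lemma 2.27 (2), proof of
Thm. 3.10 (p. 47); H. Hironaka, J. Math. Kyoto Univ. 10 (1970).
-/

noncomputable section

-- single-conjunct summit: the doubled namespace component `ResolutionOfSingularities` is mandated
set_option linter.dupNamespace false

open MvPolynomial Module IsLocalRing
open Literature.RingTheory.HilbertSamuel
open Literature.AlgebraicGeometry.Resolution

namespace Summit.ResolutionOfSingularities.ResolutionOfSingularities.Theorems

namespace CampaignW42

universe u

variable {K : Type u} [Field K] {n : ℕ} {T : Type u} [CommRing T] (π : MvPolynomial (Fin n) K →+* T)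

/-! ## The twisted embedding `θ : s ↦ s(Y + Z)` with coefficients reduced along `π : K[X] → T` -/

section Theta

variable (𝔮 : Ideal (MvPolynomial (Fin n) K))

/-- **`θ(s) ≡ π(s)` modulo `(Z)`** (and modulo every ideal containing `(Z)`): the ring homomorphisms
`s ↦ θ(s) = (map π)(s(Y+Z))` and `s ↦ C(π s)` agree modulo the variables `Z`. [folklore] -/
theorem mk_taylor_eq_mk_C (J : Ideal (MvPolynomial (Fin n) T)) (hJ : idealOfVars (Fin n) T ≤ J)
    (s : MvPolynomial (Fin n) K) :
    Ideal.Quotient.mk J ((MvPolynomial.map π) (taylorY K n s)) = Ideal.Quotient.mk J (C (π s)) := by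
  have h : ((Ideal.Quotient.mk J).comp ((MvPolynomial.map π).comp
      (taylorY K n : MvPolynomial (Fin n) K →+* MvPolynomial (Fin n) (MvPolynomial (Fin n) K)))) =
      ((Ideal.Quotient.mk J).comp C).comp π := by
    refine MvPolynomial.ringHom_ext (fun c => ?_) (fun i => ?_)
    · simp only [RingHom.comp_apply, AlgHom.coe_toRingHom, taylorY_C, map_C]
    · simp only [RingHom.comp_apply, AlgHom.coe_toRingHom, taylorY_X, map_add, map_C, map_X]
      rw [add_eq_left, Ideal.Quotient.eq_zero_iff_mem]
      exact hJ (Ideal.subset_span ⟨i, rfl⟩)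
  have := RingHom.congr_fun h s
  simpa only [RingHom.comp_apply, AlgHom.coe_toRingHom] using this

/-- `θ(s) ∈ J ↔ C(π s) ∈ J` for every ideal `J ⊇ (Z)`. [folklore] -/
theorem taylor_mem_iff_C_mem (J : Ideal (MvPolynomial (Fin n) T)) (hJ : idealOfVars (Fin n) T ≤ J)
    (s : MvPolynomial (Fin n) K) :
    (MvPolynomial.map π) (taylorY K n s) ∈ J ↔ C (π s) ∈ J := by
  rw [← Ideal.Quotient.eq_zero_iff_mem, mk_taylor_eq_mk_C π J hJ, Ideal.Quotient.eq_zero_iff_mem]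

/-- **`θ(𝔮)T[Z] + (Z) = π(𝔮)T[Z] + (Z)`** (`= 𝔑`). [folklore] -/
theorem map_taylor_sup_idealOfVars :
    𝔮.map ((MvPolynomial.map π).comp
        (taylorY K n : MvPolynomial (Fin n) K →+* MvPolynomial (Fin n) (MvPolynomial (Fin n) K))) ⊔
        idealOfVars (Fin n) T =
      (𝔮.map π).map (C : T →+* MvPolynomial (Fin n) T) ⊔ idealOfVars (Fin n) T := by
  refine le_antisymm (sup_le ?_ le_sup_right) (sup_le ?_ le_sup_right)
  · rw [Ideal.map_le_iff_le_comap]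
    intro s hs
    rw [Ideal.mem_comap, RingHom.comp_apply, AlgHom.coe_toRingHom, taylor_mem_iff_C_mem π _ le_sup_right]
    exact Ideal.mem_sup_left (Ideal.mem_map_of_mem _ (Ideal.mem_map_of_mem _ hs))
  · rw [Ideal.map_le_iff_le_comap, Ideal.map_le_iff_le_comap]
    intro s hs
    rw [Ideal.mem_comap, Ideal.mem_comap, ← taylor_mem_iff_C_mem π _ le_sup_right]
    have h := Ideal.mem_map_of_mem ((MvPolynomial.map π).comp
        (taylorY K n : MvPolynomial (Fin n) K →+* MvPolynomial (Fin n) (MvPolynomial (Fin n) K))) hs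
    rw [RingHom.comp_apply, AlgHom.coe_toRingHom] at h
    exact Ideal.mem_sup_left h

/-- **`θ⁻¹(𝔑) = 𝔮`** when `π` is onto and `ker π ⊆ 𝔮`. [folklore] -/
theorem comap_taylor_frameIdeal (hπ : Function.Surjective π) (hker : RingHom.ker π ≤ 𝔮) :
    ((𝔮.map π).map (C : T →+* MvPolynomial (Fin n) T) ⊔ idealOfVars (Fin n) T).comap
      ((MvPolynomial.map π).comp
        (taylorY K n : MvPolynomial (Fin n) K →+* MvPolynomial (Fin n) (MvPolynomial (Fin n) K))) = 𝔮 := by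
  refine le_antisymm ?_ ?_
  · intro s hs
    rw [Ideal.mem_comap, RingHom.comp_apply, AlgHom.coe_toRingHom, taylor_mem_iff_C_mem π _ le_sup_right] at hs
    have h2 : π s ∈ 𝔮.map π := by
      rw [← comap_C_map_C_sup_idealOfVars (n := n) (𝔮.map π), Ideal.mem_comap]
      exact hs
    have h3 := Ideal.comap_map_of_surjective π hπ 𝔮
    rw [← RingHom.ker_eq_comap_bot, sup_eq_left.mpr hker] at h3
    rw [← h3, Ideal.mem_comap]
    exact h2
  · rw [← Ideal.map_le_iff_le_comap, ← map_taylor_sup_idealOfVars]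
    exact le_sup_left

end Theta

/-! ## `K[X]_𝔮` is regular of dimension `n`: `H⁽⁰⁾ = Φ⁽ⁿ⁾` -/

/-- **`H⁽⁰⁾(K[X]_𝔮) = Φ⁽ⁿ⁾`** for a maximal ideal `𝔮` of `K[X_1, …, X_n]` (a regular local ring of dimension
`n`). [folklore] -/
theorem hilbertFun_localization_mvPolynomial (𝔮 : Ideal (MvPolynomial (Fin n) K)) [𝔮.IsMaximal] :
    hilbertFun (Localization.AtPrime 𝔮) = iterPSum n Phi := by
  haveI : IsRegularLocalRing (Localization.AtPrime 𝔮) := IsRegularRing.isRegularLocalRing_localization 𝔮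
  refine hilbertFun_eq_iterPSum_Phi_of_isRegularLocalRing (Localization.AtPrime 𝔮) ?_
  rw [IsLocalization.AtPrime.ringKrullDim_eq_height 𝔮 (Localization.AtPrime 𝔮),
    MvPolynomial.height_eq_of_isMaximal K n 𝔮]
  rfl

/-! ## Hironaka's base-change bound in the frame -/

section Bound

variable (𝔮 : Ideal (MvPolynomial (Fin n) K)) [𝔮.IsMaximal]
  [((𝔮.map π).map (C : T →+* MvPolynomial (Fin n) T) ⊔ idealOfVars (Fin n) T).IsPrime]
  (L : Type u) [CommRing L] [IsLocalRing L] [Algebra (MvPolynomial (Fin n) T) L]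
  [IsLocalization.AtPrime L ((𝔮.map π).map (C : T →+* MvPolynomial (Fin n) T) ⊔ idealOfVars (Fin n) T)]

/-- **Hironaka's base-change bound [H4] in the cone frame**: for `π : K[X] ↠ T` with `ker π ⊆ 𝔮`,
`𝔑 = π(𝔮)T[Z] + (Z)`, `L` a localization of `T[Z]` at `𝔑`, `θ : s ↦ s(Y+Z)` (coefficients reduced by `π`) and
`D = θ(𝔮) T[Z]`: for every `m`, `ℓ_L(L/𝔪_L^{m+1}) ≤ Σ_{i ≤ m} Φ⁽ⁿ⁾(i) · ℓ_L(L/(D + (Z)^{m+1-i})L)` (the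
tree's fibre bound for the local homomorphism `K[X]_𝔮 → L` induced by `θ`, whose source is regular of
dimension `n` and for which `𝔪_{K[X]_𝔮} L + (Z) = 𝔪_L`). [cite: CossartJannsenSaito2020, Lemma 2.27 (2)] -/
theorem length_quotient_pow_frame_le_sum (hπ : Function.Surjective π) (hker : RingHom.ker π ≤ 𝔮) (m : ℕ) :
    Module.length L (L ⧸ maximalIdeal L ^ (m + 1)) ≤
      ∑ i ∈ Finset.range (m + 1), (iterPSum n Phi i : ℕ∞) *
        Module.length L (L ⧸ (𝔮.map ((MvPolynomial.map π).comp
            (taylorY K n : MvPolynomial (Fin n) K →+* MvPolynomial (Fin n) (MvPolynomial (Fin n) K))) ⊔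
          idealOfVars (Fin n) T ^ (m + 1 - i)).map (algebraMap (MvPolynomial (Fin n) T) L)) := by
  set 𝔑 : Ideal (MvPolynomial (Fin n) T) :=
    (𝔮.map π).map (C : T →+* MvPolynomial (Fin n) T) ⊔ idealOfVars (Fin n) T with h𝔑
  set θ : MvPolynomial (Fin n) K →+* MvPolynomial (Fin n) T :=
    (MvPolynomial.map π).comp
      (taylorY K n : MvPolynomial (Fin n) K →+* MvPolynomial (Fin n) (MvPolynomial (Fin n) K)) with hθ
  set G := Localization.AtPrime 𝔮
  have hcomap : 𝔮 = 𝔑.comap θ := (comap_taylor_frameIdeal π 𝔮 hπ hker).symm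
  have hle : 𝔮.primeCompl ≤ 𝔑.primeCompl.comap θ := fun s hs h𝔑s => hs (hcomap.symm ▸ h𝔑s)
  let γ : G →+* L := IsLocalization.map L θ hle
  letI : Algebra G L := γ.toAlgebra
  have hγ : ∀ s, algebraMap G L (algebraMap (MvPolynomial (Fin n) K) G s) =
      algebraMap (MvPolynomial (Fin n) T) L (θ s) := fun s => IsLocalization.map_eq hle s
  let z : Fin n → L := fun i => algebraMap (MvPolynomial (Fin n) T) L (X i)
  have hM : (maximalIdeal G).map (algebraMap G L) = (𝔮.map θ).map (algebraMap (MvPolynomial (Fin n) T) L) := by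
    rw [← Localization.AtPrime.map_eq_maximalIdeal, Ideal.map_map, Ideal.map_map]
    congr 1
    exact RingHom.ext hγ
  have hspan : Ideal.span (Set.range z) =
      (idealOfVars (Fin n) T).map (algebraMap (MvPolynomial (Fin n) T) L) := by
    rw [idealOfVars, Ideal.map_span, ← Set.range_comp]
    rfl
  have hn : (maximalIdeal G).map (algebraMap G L) ⊔ Ideal.span (Set.range z) = maximalIdeal L := by
    rw [hM, hspan, ← Ideal.map_sup, hθ, map_taylor_sup_idealOfVars, ← h𝔑,
      IsLocalization.AtPrime.map_eq_maximalIdeal 𝔑 L]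
  have hbound := length_quotient_pow_le_sum (A := G) (B := L) z hn m
  rw [hilbertFun_localization_mvPolynomial 𝔮] at hbound
  refine hbound.trans (le_of_eq (Finset.sum_congr rfl fun i _ => ?_))
  rw [hM, hspan, ← Ideal.map_pow, ← Ideal.map_sup]

end Bound

end CampaignW42

end Summit.ResolutionOfSingularities.ResolutionOfSingularities.Theorems
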